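import Mathlib
import HarnessLib
import Summits.Ventures.LatticeQCDFlow.Scaling.TorusPlaquetteCoverOrder

/-!
# LatticeQCDFlow / Scaling — no exact plaquette cover of `(ℤ/L)^d` exists in dimension `d ≥ 5`
# (nor for odd `L`): the counting constant `d/4` of the volume law is attained only for `d ≤ 4`

HONEST FRAMING: exact (Metropolis-corrected) sampling algorithms for lattice gauge theory;
figures of merit are autocorrelation/cost numbers at stated couplings and volumes; no
continuum-physics claim.

Venture `LatticeQCDFlow` (cell pub-lqcd), topic `Scaling`, FANOUT row 30 (lean-1, GEN-23) — OUR WORK on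
THEORY-2.md §4 row C5 (autoregressive context), the COUNTING step of the volume law; the OBSTRUCTION
companion of `Scaling/TorusPlaquetteCoverOrder` (an exact plaquette cover `C` — every plaquette has
exactly one of its four links in `C` — is exactly what makes the bound `#T ≥ #plaquettes/(2(d−1))` of
`Scaling/TorusPlaquetteLastLinks.exists_lastLinks_all` an equality) and `…CoverParity` (covers exist in
`d = 2, 3, 4` for even `L`).  Here: NO exact cover exists when `d ≥ 5` (any `L ≥ 2`), and none when
`L` is odd (`d ≥ 3`; for `d = 2` too, by the same count).  So the combinatorial constant `d/4` is
attained exactly in the lattice dimensions `d ≤ 4`.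

The argument (elementary; `n_μ(x) ∈ {0,1}` the indicator of `(x, μ) ∈ C`).  The cover property reads
`n_μ(x) + n_ν(x+e_μ) + n_μ(x+e_ν) + n_ν(x) = 1` for `μ ≠ ν`.  (1) SQUARE RULE: for pairwise distinct
`μ, ν, ρ`, adding the cover identities of the planes `{μ,ν}` at `x, x+e_ρ`, of `{μ,ρ}` at `x, x+e_ν`
and subtracting those of `{ν,ρ}` at `x, x+e_μ` leaves
`2·(n_μ(x) + n_μ(x+e_ν) + n_μ(x+e_ρ) + n_μ(x+e_ν+e_ρ)) = 2`: every unit square in a plane not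
containing `μ` has EXACTLY ONE corner carrying a `μ`-link of `C`.  (2) ANTIPODE RULE: for pairwise
distinct `μ, ν, ρ, σ`, if `(x, μ) ∈ C` then the squares at `x` in the planes `{ν,ρ}, {ν,σ}, {ρ,σ}` clear
the six neighbours `x+e_ν, …, x+e_ρ+e_σ`, and the `{ν,ρ}`-square at `x+e_σ` forces
`(x+e_ν+e_ρ+e_σ, μ) ∈ C`.  (3) With a FIFTH direction `τ` the antipode rule gives both
`(x+e_ν+e_ρ+e_σ, μ)` and `(x+e_ν+e_ρ+e_τ, μ)` in `C` — two corners of the `{σ,τ}`-square at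
`x+e_ν+e_ρ`, contradicting (1).  (4) ODD `L`: summing the cover identity of a plane `{μ,ν}` over all
sites gives `2·#C_μ + 2·#C_ν = #sites = L^d`, so `L` is even.

## What is proved (all [ours])

* §1 `plaquetteCover_sum_eq_one` — the cover identity as a `0/1` sum (`L ≥ 2` makes the four links of a
  plaquette distinct), for `i ≠ j` in either order.
* §2 **`plaquetteCover_square`** — the square rule (1); **`plaquetteCover_antipode`** — rule (2).
* §3 **`not_plaquetteCover_of_five_le`** — no exact plaquette cover of `(ℤ/L)^d` for `d ≥ 5`, `L ≥ 2`.
* §4 **`even_of_plaquetteCover`** — an exact cover forces `L` even (`d ≥ 2`, `L ≥ 2`).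

Pure lattice combinatorics.  No `def`, no `sorry`, nothing cited as a fact.
-/

namespace Summit.Ventures.LatticeQCDFlow.Theory2.Autoregressive

open Literature.MathematicalPhysics.QuantumFieldTheory

/-! ## §1 The cover identity as a `0/1` sum -/

/-- **The cover identity.**  For an exact plaquette cover `C` of `(ℤ/L)^d`, `L ≥ 2`, and directions
`i ≠ j`: `n(x,i) + n(x+e_i,j) + n(x+e_j,i) + n(x,j) = 1`, `n` the indicator of `C`. [ours] -/
theorem plaquetteCover_sum_eq_one {d L : ℕ} [NeZero L] (hL : 2 ≤ L) (C : Finset (Edge d L))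
    (hC : ∀ p : Plaquette d L, ∃ e ∈ ({(p.1, p.2.1.1), (p.1.shift p.2.1.1, p.2.1.2),
        (p.1.shift p.2.1.2, p.2.1.1), (p.1, p.2.1.2)} : Finset (Edge d L)),
      e ∈ C ∧ ∀ e' ∈ ({(p.1, p.2.1.1), (p.1.shift p.2.1.1, p.2.1.2),
        (p.1.shift p.2.1.2, p.2.1.1), (p.1, p.2.1.2)} : Finset (Edge d L)), e' ≠ e → e' ∉ C)
    (x : Site d L) {i j : Fin d} (hij : i ≠ j) :
    (if (x, i) ∈ C then 1 else 0) + (if (x + Pi.single i 1, j) ∈ C then 1 else 0) +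
      (if (x + Pi.single j 1, i) ∈ C then 1 else 0) + (if (x, j) ∈ C then 1 else 0) = 1 := by
  classical
  haveI : Fact (1 < L) := ⟨hL⟩
  have hsingle : ∀ k : Fin d, (Pi.single k (1 : ZMod L) : Site d L) ≠ 0 := by
    intro k h
    have := congrFun h k
    simp at this
  -- the `i < j` case, for an arbitrary ordered pair
  have key : ∀ (a b : Fin d) (hab : a < b),
      (if (x, a) ∈ C then 1 else 0) + (if (x + Pi.single a 1, b) ∈ C then 1 else 0) +
        (if (x + Pi.single b 1, a) ∈ C then 1 else 0) + (if (x, b) ∈ C then 1 else 0) = 1 := by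
    intro a b hab
    have hne : a ≠ b := ne_of_lt hab
    obtain ⟨e, he, heC, hoth⟩ := hC (x, ⟨(a, b), hab⟩)
    simp only [Site.shift, Finset.mem_insert, Finset.mem_singleton] at he hoth
    -- pairwise distinctness of the four links
    have d12 : (x, a) ≠ (x + Pi.single a 1, b) := fun h => hne (congrArg Prod.snd h)
    have d13 : (x, a) ≠ (x + Pi.single b 1, a) := fun h =>
      hsingle b (left_eq_add.1 (congrArg Prod.fst h))
    have d14 : (x, a) ≠ (x, b) := fun h => hne (congrArg Prod.snd h)
    have d23 : (x + Pi.single a 1, b) ≠ (x + Pi.single b 1, a) := fun h => hne (congrArg Prod.snd h).symm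
    have d24 : (x + Pi.single a 1, b) ≠ (x, b) := fun h =>
      hsingle a (add_eq_left.1 (congrArg Prod.fst h))
    have d34 : (x + Pi.single b 1, a) ≠ (x, b) := fun h => hne (congrArg Prod.snd h)
    rcases he with rfl | rfl | rfl | rfl
    · have h2 := hoth _ (Or.inr (Or.inl rfl)) d12.symm
      have h3 := hoth _ (Or.inr (Or.inr (Or.inl rfl))) d13.symm
      have h4 := hoth _ (Or.inr (Or.inr (Or.inr rfl))) d14.symm
      simp [heC, h2, h3, h4]
    · have h1 := hoth _ (Or.inl rfl) d12
      have h3 := hoth _ (Or.inr (Or.inr (Or.inl rfl))) d23.symm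
      have h4 := hoth _ (Or.inr (Or.inr (Or.inr rfl))) d24.symm
      simp [heC, h1, h3, h4]
    · have h1 := hoth _ (Or.inl rfl) d13
      have h2 := hoth _ (Or.inr (Or.inl rfl)) d23
      have h4 := hoth _ (Or.inr (Or.inr (Or.inr rfl))) d34.symm
      simp [heC, h1, h2, h4]
    · have h1 := hoth _ (Or.inl rfl) d14
      have h2 := hoth _ (Or.inr (Or.inl rfl)) d24
      have h3 := hoth _ (Or.inr (Or.inr (Or.inl rfl))) d34
      simp [heC, h1, h2, h3]
  rcases lt_or_gt_of_ne hij with h | h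
  · exact key i j h
  · have := key j i h
    omega

/-! ## §2 The square rule and the antipode rule -/

/-- **Square rule.**  For an exact plaquette cover of `(ℤ/L)^d` (`L ≥ 2`) and pairwise distinct
directions `μ, ν, ρ`, every unit square in the `{ν, ρ}` plane has exactly one corner `y` with
`(y, μ) ∈ C`: `n_μ(x) + n_μ(x+e_ν) + n_μ(x+e_ρ) + n_μ(x+e_ν+e_ρ) = 1`. [ours] -/
theorem plaquetteCover_square {d L : ℕ} [NeZero L] (hL : 2 ≤ L) (C : Finset (Edge d L))
    (hC : ∀ p : Plaquette d L, ∃ e ∈ ({(p.1, p.2.1.1), (p.1.shift p.2.1.1, p.2.1.2),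
        (p.1.shift p.2.1.2, p.2.1.1), (p.1, p.2.1.2)} : Finset (Edge d L)),
      e ∈ C ∧ ∀ e' ∈ ({(p.1, p.2.1.1), (p.1.shift p.2.1.1, p.2.1.2),
        (p.1.shift p.2.1.2, p.2.1.1), (p.1, p.2.1.2)} : Finset (Edge d L)), e' ≠ e → e' ∉ C)
    (x : Site d L) {μ ν ρ : Fin d} (hμν : μ ≠ ν) (hμρ : μ ≠ ρ) (hνρ : ν ≠ ρ) :
    (if (x, μ) ∈ C then 1 else 0) + (if (x + Pi.single ν 1, μ) ∈ C then 1 else 0) +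
      (if (x + Pi.single ρ 1, μ) ∈ C then 1 else 0) +
        (if (x + Pi.single ν 1 + Pi.single ρ 1, μ) ∈ C then 1 else 0) = 1 := by
  classical
  set n : Edge d L → ℕ := fun e => if e ∈ C then 1 else 0 with hn
  have P : ∀ (y : Site d L) {a b : Fin d}, a ≠ b →
      n (y, a) + n (y + Pi.single a 1, b) + n (y + Pi.single b 1, a) + n (y, b) = 1 :=
    fun y a b hab => plaquetteCover_sum_eq_one hL C hC y hab
  have h1 := P x hμν
  have h2 := P (x + Pi.single ρ 1) hμν
  have h3 := P x hμρ
  have h4 := P (x + Pi.single ν 1) hμρ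
  have h5 := P x hνρ
  have h6 := P (x + Pi.single μ 1) hνρ
  rw [add_right_comm x (Pi.single ρ 1) (Pi.single μ 1), add_right_comm x (Pi.single ρ 1) (Pi.single ν 1)] at h2
  rw [add_right_comm x (Pi.single ν 1) (Pi.single μ 1)] at h4
  show n (x, μ) + n (x + Pi.single ν 1, μ) + n (x + Pi.single ρ 1, μ) +
    n (x + Pi.single ν 1 + Pi.single ρ 1, μ) = 1
  omega

/-- **Antipode rule.**  For an exact plaquette cover of `(ℤ/L)^d` (`L ≥ 2`) and pairwise distinct
directions `μ, ν, ρ, σ`: if `(x, μ) ∈ C` then `(x + e_ν + e_ρ + e_σ, μ) ∈ C` (the squares at `x` in the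
planes `{ν,ρ}, {ν,σ}, {ρ,σ}` clear the six intermediate corners; the `{ν,ρ}` square at `x + e_σ` then
has no other corner left). [ours] -/
theorem plaquetteCover_antipode {d L : ℕ} [NeZero L] (hL : 2 ≤ L) (C : Finset (Edge d L))
    (hC : ∀ p : Plaquette d L, ∃ e ∈ ({(p.1, p.2.1.1), (p.1.shift p.2.1.1, p.2.1.2),
        (p.1.shift p.2.1.2, p.2.1.1), (p.1, p.2.1.2)} : Finset (Edge d L)),
      e ∈ C ∧ ∀ e' ∈ ({(p.1, p.2.1.1), (p.1.shift p.2.1.1, p.2.1.2),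
        (p.1.shift p.2.1.2, p.2.1.1), (p.1, p.2.1.2)} : Finset (Edge d L)), e' ≠ e → e' ∉ C)
    (x : Site d L) {μ ν ρ σ : Fin d} (hμν : μ ≠ ν) (hμρ : μ ≠ ρ) (hμσ : μ ≠ σ) (hνρ : ν ≠ ρ)
    (hνσ : ν ≠ σ) (hρσ : ρ ≠ σ) (hx : (x, μ) ∈ C) :
    (x + Pi.single ν 1 + Pi.single ρ 1 + Pi.single σ 1, μ) ∈ C := by
  classical
  set n : Edge d L → ℕ := fun e => if e ∈ C then 1 else 0 with hn
  have S : ∀ (y : Site d L) {a b : Fin d}, μ ≠ a → μ ≠ b → a ≠ b →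
      n (y, μ) + n (y + Pi.single a 1, μ) + n (y + Pi.single b 1, μ) +
        n (y + Pi.single a 1 + Pi.single b 1, μ) = 1 :=
    fun y a b h1 h2 h3 => plaquetteCover_square hL C hC y h1 h2 h3
  have hxμ : n (x, μ) = 1 := by simp [hn, hx]
  have s1 := S x hμν hμρ hνρ
  have s2 := S x hμν hμσ hνσ
  have s3 := S x hμρ hμσ hρσ
  have s4 := S (x + Pi.single σ 1) hμν hμρ hνρ
  -- canonical forms of the corners of the shifted square
  rw [add_right_comm x (Pi.single σ 1) (Pi.single ν 1),
    add_right_comm x (Pi.single σ 1) (Pi.single ρ 1),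
    add_right_comm (x + Pi.single ν 1) (Pi.single σ 1) (Pi.single ρ 1)] at s4
  have goal : n (x + Pi.single ν 1 + Pi.single ρ 1 + Pi.single σ 1, μ) = 1 := by omega
  by_contra h
  simp [hn, h] at goal

/-! ## §3 No exact cover in dimension `d ≥ 5` -/

/-- **No exact plaquette cover of `(ℤ/L)^d` for `d ≥ 5`** (`L ≥ 2`).  Take a direction `μ` and four
further directions `ν, ρ, σ, τ`; some `(x, μ) ∈ C` (square rule); the antipode rule puts both
`(x+e_ν+e_ρ+e_σ, μ)` and `(x+e_ν+e_ρ+e_τ, μ)` in `C` — two corners of the `{σ, τ}` square at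
`x+e_ν+e_ρ`, against the square rule.  Hence the counting constant `d/4` of the volume law
(`Scaling/TorusPlaquetteCoverOrder`) is NOT attained in dimension `≥ 5`. [ours] -/
theorem not_plaquetteCover_of_five_le {d L : ℕ} [NeZero L] (hd : 5 ≤ d) (hL : 2 ≤ L)
    (C : Finset (Edge d L))
    (hC : ∀ p : Plaquette d L, ∃ e ∈ ({(p.1, p.2.1.1), (p.1.shift p.2.1.1, p.2.1.2),
        (p.1.shift p.2.1.2, p.2.1.1), (p.1, p.2.1.2)} : Finset (Edge d L)),
      e ∈ C ∧ ∀ e' ∈ ({(p.1, p.2.1.1), (p.1.shift p.2.1.1, p.2.1.2),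
        (p.1.shift p.2.1.2, p.2.1.1), (p.1, p.2.1.2)} : Finset (Edge d L)), e' ≠ e → e' ∉ C) :
    False := by
  classical
  set n : Edge d L → ℕ := fun e => if e ∈ C then 1 else 0 with hn
  -- five distinct directions
  set μ : Fin d := ⟨0, by omega⟩ with hμ
  set ν : Fin d := ⟨1, by omega⟩ with hν
  set ρ : Fin d := ⟨2, by omega⟩ with hρ
  set σ : Fin d := ⟨3, by omega⟩ with hσ
  set τ : Fin d := ⟨4, by omega⟩ with hτ
  have hμν : μ ≠ ν := by simp [hμ, hν, Fin.ext_iff]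
  have hμρ : μ ≠ ρ := by simp [hμ, hρ, Fin.ext_iff]
  have hμσ : μ ≠ σ := by simp [hμ, hσ, Fin.ext_iff]
  have hμτ : μ ≠ τ := by simp [hμ, hτ, Fin.ext_iff]
  have hνρ : ν ≠ ρ := by simp [hν, hρ, Fin.ext_iff]
  have hνσ : ν ≠ σ := by simp [hν, hσ, Fin.ext_iff]
  have hντ : ν ≠ τ := by simp [hν, hτ, Fin.ext_iff]
  have hρσ : ρ ≠ σ := by simp [hρ, hσ, Fin.ext_iff]
  have hρτ : ρ ≠ τ := by simp [hρ, hτ, Fin.ext_iff]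
  have hστ : σ ≠ τ := by simp [hσ, hτ, Fin.ext_iff]
  have S : ∀ (y : Site d L) {a b : Fin d}, μ ≠ a → μ ≠ b → a ≠ b →
      n (y, μ) + n (y + Pi.single a 1, μ) + n (y + Pi.single b 1, μ) +
        n (y + Pi.single a 1 + Pi.single b 1, μ) = 1 :=
    fun y a b h1 h2 h3 => plaquetteCover_square hL C hC y h1 h2 h3
  -- some `μ`-link of `C`, from the square at the origin
  have hex : ∃ x : Site d L, (x, μ) ∈ C := by
    have s0 := S 0 hμν hμρ hνρ
    by_contra hnone
    push Not at hnone
    have z : ∀ y : Site d L, n (y, μ) = 0 := fun y => by simp [hn, hnone y]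
    rw [z, z, z, z] at s0
    omega
  obtain ⟨x, hx⟩ := hex
  have p1 := plaquetteCover_antipode hL C hC x hμν hμρ hμσ hνρ hνσ hρσ hx
  have p2 := plaquetteCover_antipode hL C hC x hμν hμρ hμτ hνρ hντ hρτ hx
  have hp1 : n (x + Pi.single ν 1 + Pi.single ρ 1 + Pi.single σ 1, μ) = 1 := by simp [hn, p1]
  have hp2 : n (x + Pi.single ν 1 + Pi.single ρ 1 + Pi.single τ 1, μ) = 1 := by simp [hn, p2]
  have s := S (x + Pi.single ν 1 + Pi.single ρ 1) hμσ hμτ hστ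
  omega

/-! ## §4 Odd `L`: no exact cover -/

/-- **An exact plaquette cover forces `L` even** (`d ≥ 2`, `L ≥ 2`): summing the cover identity of a
plane `{μ, ν}` over all base sites counts every `μ`-link and every `ν`-link of `C` twice, so
`2·(#C_μ + #C_ν) = #sites = L^d`. [ours] -/
theorem even_of_plaquetteCover {d L : ℕ} [NeZero L] (hd : 2 ≤ d) (hL : 2 ≤ L)
    (C : Finset (Edge d L))
    (hC : ∀ p : Plaquette d L, ∃ e ∈ ({(p.1, p.2.1.1), (p.1.shift p.2.1.1, p.2.1.2),
        (p.1.shift p.2.1.2, p.2.1.1), (p.1, p.2.1.2)} : Finset (Edge d L)),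
      e ∈ C ∧ ∀ e' ∈ ({(p.1, p.2.1.1), (p.1.shift p.2.1.1, p.2.1.2),
        (p.1.shift p.2.1.2, p.2.1.1), (p.1, p.2.1.2)} : Finset (Edge d L)), e' ≠ e → e' ∉ C) :
    Even L := by
  classical
  set n : Edge d L → ℕ := fun e => if e ∈ C then 1 else 0 with hn
  set μ : Fin d := ⟨0, by omega⟩ with hμ
  set ν : Fin d := ⟨1, by omega⟩ with hν
  have hμν : μ ≠ ν := by simp [hμ, hν, Fin.ext_iff]
  have P : ∀ y : Site d L,
      n (y, μ) + n (y + Pi.single μ 1, ν) + n (y + Pi.single ν 1, μ) + n (y, ν) = 1 :=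
    fun y => plaquetteCover_sum_eq_one hL C hC y hμν
  -- sum over all sites; translated sums equal untranslated ones
  have hsum : ∑ y : Site d L, (n (y, μ) + n (y + Pi.single μ 1, ν) + n (y + Pi.single ν 1, μ) +
      n (y, ν)) = Fintype.card (Site d L) := by
    simp only [P, Finset.sum_const, Finset.card_univ, smul_eq_mul, mul_one]
  have ht1 : ∑ y : Site d L, n (y + Pi.single μ 1, ν) = ∑ y : Site d L, n (y, ν) :=
    Fintype.sum_equiv (Equiv.addRight (Pi.single μ 1)) _ _ (fun y => rfl)
  have ht2 : ∑ y : Site d L, n (y + Pi.single ν 1, μ) = ∑ y : Site d L, n (y, μ) :=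
    Fintype.sum_equiv (Equiv.addRight (Pi.single ν 1)) _ _ (fun y => rfl)
  simp only [Finset.sum_add_distrib, ht1, ht2] at hsum
  have hcard : Fintype.card (Site d L) = L ^ d := by
    simp [Fintype.card_pi, ZMod.card, Finset.prod_const, Finset.card_univ, Fintype.card_fin]
  rw [hcard] at hsum
  have heven : Even (L ^ d) := ⟨∑ y : Site d L, n (y, μ) + ∑ y : Site d L, n (y, ν), by omega⟩
  exact (Nat.even_pow' (by omega)).1 heven

end Summit.Ventures.LatticeQCDFlow.Theory2.Autoregressive
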